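import Mathlib
import Summits.Ventures.PercRepro2.Tail2DBlockCalc
import Summits.Ventures.PercRepro2.Tail2DHarrisSP
import Summits.Ventures.PercRepro2.Tail2DFlowOneBlocks
import Summits.Ventures.PercRepro2.Tail2DFlowOneStep01
import Summits.Ventures.PercRepro2.Tail2DParFin
import Summits.Ventures.PercRepro2.Tail2DParFinFlip
import Summits.Ventures.PercRepro2.Tail2DParFinTop
import Summits.Ventures.PercRepro2.Tail2DParFinCount

/-!
# The tail counts of `k` flow-one factors as sums over the fibres (C-set, number of blues)
(seat mine-b, cell pub-perc-repro2; conjectures/MINE-B.md §44)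

`tailCount_parFin_fibres`: `|E(u,v)| = Σ_S Σ_j [u ≤ k − #S − j ∧ v ≤ j] · C(k − #S, j) · Π_{i∈S} #C_i · Π_{i∉S} #R_i`
at every position, and for IDENTICAL factors `X i = Y` the sum over the `C`-sets collapses to a sum over their
sizes (`tailCount_parFin_ident`): `|E(u,v)| = Σ_s C(k,s) Σ_j [u ≤ k − s − j ∧ v ≤ j] C(k − s, j) c^s a^{k−s}`.
-/

namespace Summit.Ventures.PercRepro2.Tail2D

open V2Closure Finset

section Fibres

variable (k : ℕ) (X : Fin k → V2Closure.SP)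

/-- the tail count as a double sum over the `C`-set and the number of blues -/
theorem tailCount_parFin_fibres (hX : ∀ i, FlowOne (X i)) (u v : ℕ) :
    (tailCount (parFin k X) u v : ℚ)
      = ∑ S : Finset (Fin k), ∑ j ∈ Finset.range (k + 1),
          (if u ≤ k - S.card - j ∧ v ≤ j then ((k - S.card).choose j : ℚ)
            * ((∏ i ∈ S, ((cellSet (X i)).card : ℚ)) * ∏ i ∈ Sᶜ, ((rSet (X i)).card : ℚ)) else 0) := by
  rw [tailCount_parFin_eq_sum k X hX]
  push_cast
  -- group the words by (C-set, number of blues)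
  have hmaps : ∀ w ∈ (Finset.univ.filter (fun w : Fin k → Ltr => u ≤ nR k w ∧ v ≤ nB k w)),
      (cSet k w, nB k w) ∈ (Finset.univ : Finset (Finset (Fin k))) ×ˢ Finset.range (k + 1) := by
    intro w _
    rw [Finset.mem_product, Finset.mem_range]
    refine ⟨Finset.mem_univ _, ?_⟩
    have := nR_add_nB_add_nC k w
    omega
  rw [← Finset.sum_fiberwise_of_maps_to hmaps (fun w => ((blockOf k X w).card : ℚ)), Finset.sum_product]
  refine Finset.sum_congr rfl (fun S _ => Finset.sum_congr rfl (fun j _ => ?_))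
  -- the fibre over (S, j)
  have hfib : (Finset.univ.filter (fun w : Fin k → Ltr => u ≤ nR k w ∧ v ≤ nB k w)).filter
      (fun w => (cSet k w, nB k w) = (S, j))
      = if u ≤ k - S.card - j ∧ v ≤ j then Finset.univ.filter (fun w : Fin k → Ltr => cSet k w = S ∧ nB k w = j)
        else ∅ := by
    ext w
    simp only [Finset.mem_filter, Finset.mem_univ, true_and, Prod.mk.injEq]
    have h3 := nR_add_nB_add_nC k w
    by_cases hc : u ≤ k - S.card - j ∧ v ≤ j
    · rw [if_pos hc]
      simp only [Finset.mem_filter, Finset.mem_univ, true_and]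
      constructor
      · rintro ⟨-, h1, h2⟩; exact ⟨h1, h2⟩
      · rintro ⟨h1, h2⟩
        have : nC k w = S.card := by unfold nC; rw [h1]
        refine ⟨⟨?_, ?_⟩, h1, h2⟩ <;> omega
    · rw [if_neg hc]
      simp only [Finset.notMem_empty, iff_false, not_and]
      rintro ⟨h1, h2⟩ h4 h5
      apply hc
      have : nC k w = S.card := by unfold nC; rw [h4]
      constructor <;> omega
  rw [hfib]
  by_cases hc : u ≤ k - S.card - j ∧ v ≤ j
  · rw [if_pos hc, if_pos hc, sum_fibre]
  · rw [if_neg hc, if_neg hc, Finset.sum_empty]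

end Fibres

section Ident

variable (k : ℕ) (Y : V2Closure.SP)

/-- for identical factors the fibre sum collapses to a sum over the sizes of the `C`-sets -/
theorem tailCount_parFin_ident (hY : FlowOne Y) (u v : ℕ) :
    (tailCount (parFin k (fun _ => Y)) u v : ℚ)
      = ∑ s ∈ Finset.range (k + 1), (k.choose s : ℚ) * ∑ j ∈ Finset.range (k + 1),
          (if u ≤ k - s - j ∧ v ≤ j then ((k - s).choose j : ℚ)
            * (((cellSet Y).card : ℚ) ^ s * ((rSet Y).card : ℚ) ^ (k - s)) else 0) := by
  rw [tailCount_parFin_fibres k (fun _ => Y) (fun _ => hY) u v]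
  have e : ∀ S : Finset (Fin k), (∑ j ∈ Finset.range (k + 1),
      (if u ≤ k - S.card - j ∧ v ≤ j then ((k - S.card).choose j : ℚ)
        * ((∏ _i ∈ S, ((cellSet Y).card : ℚ)) * ∏ _i ∈ Sᶜ, ((rSet Y).card : ℚ)) else 0))
      = (fun s => ∑ j ∈ Finset.range (k + 1), (if u ≤ k - s - j ∧ v ≤ j then ((k - s).choose j : ℚ)
          * (((cellSet Y).card : ℚ) ^ s * ((rSet Y).card : ℚ) ^ (k - s)) else 0)) S.card := by
    intro S
    simp only [Finset.prod_const, Finset.card_compl, Fintype.card_fin]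
  rw [Finset.sum_congr rfl (fun S _ => e S), ← Finset.powerset_univ,
    Finset.sum_powerset_apply_card (fun s => ∑ j ∈ Finset.range (k + 1), (if u ≤ k - s - j ∧ v ≤ j
      then ((k - s).choose j : ℚ) * (((cellSet Y).card : ℚ) ^ s * ((rSet Y).card : ℚ) ^ (k - s)) else 0))]
  simp only [Finset.card_univ, Fintype.card_fin, nsmul_eq_mul]

end Ident

end Summit.Ventures.PercRepro2.Tail2D
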